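import Summits.Ventures.PercRepro.SixFourResidueList
import Summits.Ventures.PercRepro.SixFourResidueS0
import Summits.Ventures.PercRepro.SixFourResidueSteps
import Summits.Ventures.PercRepro.SixFourT4Identity
import Summits.Ventures.PercRepro.SixFourPLTraceK

/-!
# PercRepro — C-025 at `(6,4)`: the MATROID SIDE of the `g ∈ {8, 9}` plane-line piece of `SixFourResidue` (p2, gen 8 —
part 2; part 1 = `SixFourResidueList.lean`, the data side)

Profile completeness with the cap (`constraintsK_profile`, `profile_mem_LISTK` — proved on the size facts of
`SixFourResidueSize`), the four steps of Theorem 22.12 with the cap `g − 3` (steps (1)–(3) proved in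
`SixFourResidueSteps`; step (4) = Lemma X̄′, mine-2's `Xcnt_le_Xbar'_profile` of `SixFourPLTraceK`),
Theorem 22.12′ `J15'_profile_le` (assembled),
the structure `S₀` (`Xcnt_le_fifty_of_profile_pi0` PROVED via `SixFourResidueS0`; `fifteen_J_ge_of_profile_pi0` assembled) and THE PIECE
`J_four_nonneg_of_planeLine_small` (assembled): `0 ≤ J₄(G)` for every plane-line solid with `8 ≤ g ≤ 9` and plane
traces `≤ g − 3` — the (γ) half of the clause `typeOf M G = 4 → G.card ≤ 9 → 0 ≤ J M G 4` of `SixFourResidue`.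
-/

namespace PercRepro.SixFour

/-! ## The matroid side: the `K`-forms of the size facts and of profile completeness -/

open Finset ThmH

variable {α : Type*} [DecidableEq α] {M : Matroid α} [M.Finite] {G : Finset α}

/-- `PL.ch` is the binomial coefficient. -/
theorem PL_ch_eq_choose (n k : ℕ) : PL.ch n k = n.choose k := by
  unfold PL.ch
  split_ifs with h
  · exact (Nat.choose_eq_factorial_div_factorial h).symm
  · exact (Nat.choose_eq_zero_of_lt (not_le.1 h)).symm

/-- `F5(g) = 5·F(g)` (the `F5_eq` of p3's assembly, restated on the landed names). -/
theorem PL_F5_eq (g : ℕ) : (PL.F5 g : ℚ) = 5 * Fg g := by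
  unfold PL.F5 Fg S3
  simp only [PL_ch_eq_choose]
  push_cast
  ring

namespace PLData

variable {D : PLData M G}

/-- **`ConstraintsK g K (profile D)`** for every normalisation of a plane-line set of a simple matroid with plane
traces `≤ K ≤ 7` and `g = K + 3` (the `K`-form of `constraints_profile`). -/
theorem constraintsK_profile (hs : Simple M) (hG : G ⊆ gr M) {K : ℕ} (hK7 : K ≤ 7)
    (hpl : ∀ P ∈ planes M, (P ∩ G).card ≤ K) (hg : G.card = K + 3) :
    PL.ConstraintsK G.card K D.profile := by
  obtain ⟨hne, hp4, hpK, hn3⟩ := size_facts_K (D := D) hs hG hpl hg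
  have h2 : 2 ≤ D.L.card := by omega
  have he := e_profile_eq (D := D) hs hG h2
  have hcardℓ := D.card_ellF_inter_le_one hs hG h2
  have hℓρ : (D.ellF ∩ D.ρ).card ≤ 1 :=
    (Finset.card_le_card (Finset.inter_subset_inter (Finset.Subset.refl _) Finset.inter_subset_left)).trans hcardℓ
  have hsum := D.card_ρ_add_card_L
  have hp : D.profile.p = D.ρ.card := rfl
  have hn : D.profile.n = D.L.card := rfl
  unfold PL.ConstraintsK
  rw [hp, hn, he]
  refine ⟨hp4, hpK, hn3, by omega, hsum, by simp [profile], ?_, ?_, sizes_pairwise, ?_, ?_, ?_⟩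
  · intro i hi hp
    exact inc_profile_eq_zero i hi hp
  · exact pair_identity_profile hs hG (by omega)
  · intro s hs'
    obtain ⟨y, hy, rfl⟩ := mem_sizes.1 hs'
    have := card_lam_add_card_L_le_K hs hG h2 hpl hy
    show (D.lam y).card ≤ K - D.L.card
    omega
  · -- the case split on `meet`
    have hmeet : D.profile.meet = decide ((D.ellF ∩ D.ρ).card = 1) := rfl
    have hsizes : D.profile.sizes = D.sizes := rfl
    rw [hmeet, hsizes]
    have key := sum_card_classes hs hG h2
    by_cases h1 : (D.ellF ∩ D.ρ).card = 1
    · rw [if_pos (by simpa using h1)]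
      rw [h1] at key
      refine ⟨fun s hs' => ?_, ?_⟩
      · obtain ⟨y, hy, rfl⟩ := mem_sizes.1 hs'
        have := one_le_card_class (Finset.mem_image.2 ⟨y, hy, rfl⟩) hs hG h2
        rw [h1] at this
        exact this
      · rw [sizes_sum_pred, key]
    · rw [if_neg (by simpa using h1)]
      have h0 : (D.ellF ∩ D.ρ).card = 0 := by omega
      rw [h0] at key
      simp only [Nat.sub_zero] at key
      refine ⟨fun s hs' => ?_, ?_⟩
      · obtain ⟨y, hy, rfl⟩ := mem_sizes.1 hs'
        have := one_le_card_class (Finset.mem_image.2 ⟨y, hy, rfl⟩) hs hG h2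
        rw [h0] at this
        exact this
      · rw [sizes_sum, key]
  · intro m hm2 hm7
    have hsizes : D.profile.sizes = D.sizes := rfl
    rw [hsizes, sizes_count, inc_profile (m - 2) (by omega), show m - 2 + 2 = m by omega]
    exact card_classes_le_inc hs hG h2 hm2

/-- **Profile completeness with the cap `K = g − 3`** (§21.18.9.1): the coarse profile of every normalised
plane-line set with plane traces `≤ g − 3` (`g ≤ 10`) is in `LISTK g (g − 3)`. -/
theorem profile_mem_LISTK (hs : Simple M) (hG : G ⊆ gr M) (hpl : ∀ P ∈ planes M, (P ∩ G).card + 3 ≤ G.card)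
    (hg : 3 ≤ G.card) (hg10 : G.card ≤ 10) : D.profile ∈ PL.LISTK G.card (G.card - 3) :=
  PL.mem_LISTK_of_constraintsK (by omega)
    (constraintsK_profile hs hG (by omega) (fun P hP => by have := hpl P hP; omega) (by omega))

/-! ## Theorem 22.12′: the four steps with the cap `g − 3` and Lemma X̄′ -/

/-! Step (4) with Lemma X̄′ (§21.18.9.2, clarification 3): `Xcnt_le_Xbar'_profile` is mine-2's `SixFourPLTraceK.lean`
(imported above; `g ≤ 10` is needed: the six-entry `inc` sees no `≥ 8`-lines). -/

/-- **Theorem 22.12′ (§21.18.4 (b), §21.18.9)**: `15·Jlow′(π(G)) ≤ 15·J₄(G)` for every normalisation `D` of a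
plane-line set with plane traces `≤ g − 3` and `7 ≤ g ≤ 10` — the identity 22.1 (`J_four_identity`) with the four
steps substituted (`J15_profile_le` of p3's assembly with `Xbar'` for `Xbar`). -/
theorem J15'_profile_le (hs : Simple M) (hG : G ⊆ gr M) (hr : M.eRk (G : Set α) = 4)
    (hpl : ∀ P ∈ planes M, (P ∩ G).card + 3 ≤ G.card) (hg : 7 ≤ G.card) (hg10 : G.card ≤ 10) :
    (PL.J15' D.profile : ℚ) ≤ 15 * J M G 4 := by
  have hid := J_four_identity hs hG hr
  have hcost := cost_profile_le_K (D := D) hs hG hpl hg hg10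
  have hbonus := bonus5sum_profile_le_K (D := D) hs hG hpl hg hg10
  have hlpp := lpp_profile_le_K (D := D) hs hG hpl hg hg10
  have hX : (Xcnt M G : ℚ) ≤ (PL.Xbar' D.profile : ℚ) := by
    exact_mod_cast Xcnt_le_Xbar'_profile (D := D) hs hG hr hpl hg hg10
  have hF : (PL.F5 (PL.g D.profile) : ℚ) = 5 * Fg G.card := by
    rw [g_profile_eq]
    exact PL_F5_eq _
  unfold PL.J15'
  push_cast
  rw [hid]
  linarith

/-- The list values at `π₀` (§21.18.9.3): `5F(8) = 650`, `5cost = 264`, `5bonus = 20`, `lpp = 60`, `X̄′ = 128`. -/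
theorem pi0_values : PL.F5 8 = 650 ∧ PL.cost5sum PL.pi0 = 264 ∧ PL.bonus5sum PL.pi0 = 20 ∧ PL.lpp PL.pi0 = 60 ∧
    PL.Xbar' PL.pi0 = 128 := by
  decide +kernel

/-- **The structure `S₀`, step (4′) (§21.18.9.3)**: a plane-line solid on `8` points with profile `π₀` has
`ρ = μ ∪ {z}` (`μ` the `4`-line of `ρ`, `z = ℓ ∩ ρ ∉ μ`, the classes the `2`-lines `{y, z}`), so by
`plane_trichotomy` every rank-`3` plane trace is one of the eight `5`-sets `ρ`, `L ∪ {z, y}` (`y ∈ μ`),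
`{x} ∪ μ` (`x ∈ L`); every `Z` counted by `X` and its complement lie in such traces (`exists_plane_superset3`),
and the count of those `Z` on the labelled structure is `X_list = 50` (`decide` over the `2^8` subsets —
mine-2's `S0Decide.lean`). -/
theorem Xcnt_le_fifty_of_profile_pi0 (hs : Simple M) (hG : G ⊆ gr M) (hr : M.eRk (G : Set α) = 4)
    (hπ : D.profile = PL.pi0) : Xcnt M G ≤ 50 :=
  Xcnt_le_fifty_of_pi0 hs hG hr hπ

/-- **The structure `S₀` (§21.18.9.3)**: with profile `π₀` on `8` points, the identity 22.1 with steps (1)–(3) at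
`π₀` and `X ≤ 50` gives `15·J₄ ≥ 3·650 − 3·264 + 3·20 + 10·60 − 18·50 = 918`. -/
theorem fifteen_J_ge_of_profile_pi0 (hs : Simple M) (hG : G ⊆ gr M) (hr : M.eRk (G : Set α) = 4)
    (hpl : ∀ P ∈ planes M, (P ∩ G).card + 3 ≤ G.card) (hg : G.card = 8) (hπ : D.profile = PL.pi0) :
    (918 : ℚ) ≤ 15 * J M G 4 := by
  have hid := J_four_identity hs hG hr
  have hcost := cost_profile_le_K (D := D) hs hG hpl (by omega) (by omega)
  have hbonus := bonus5sum_profile_le_K (D := D) hs hG hpl (by omega) (by omega)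
  have hlpp := lpp_profile_le_K (D := D) hs hG hpl (by omega) (by omega)
  have hX : (Xcnt M G : ℚ) ≤ 50 := by
    exact_mod_cast Xcnt_le_fifty_of_profile_pi0 (D := D) hs hG hr hπ
  obtain ⟨hF5, hc, hb, hl, -⟩ := pi0_values
  have hF : Fg G.card = 130 := by
    have := PL_F5_eq 8
    rw [hF5] at this
    rw [hg]
    push_cast at this
    linarith
  rw [hπ, hc] at hcost
  rw [hπ, hb] at hbonus
  rw [hπ, hl] at hlpp
  push_cast at hcost hbonus hlpp
  rw [hid, hF]
  linarith

end PLData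

/-! ## The piece -/

/-- **The (γ) plane-line piece of the `g ≤ 9` clause of `SixFourResidue` (§21.18.9, Theorem 22″ at `g = 8, 9`)**:
for every simple matroid and every non-generic rank-`4` set `G ⊆ E` with `8 ≤ g ≤ 9` points whose plane traces all
have `≤ g − 3` points, `0 ≤ J₄(G)`.  (With the (α) generic half — Theorem G for `7 ≤ g ≤ 9` — and the (β) half —
some plane trace `≥ g − 2`, Prop. 21.5 / Theorem 21.6 — and `g ≤ 7` this is the clause
`typeOf M G = 4 → G.card ≤ 9 → 0 ≤ J M G 4` of `SixFourResidue`.) -/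
theorem J_four_nonneg_of_planeLine_small (hs : Simple M) (hG : G ⊆ gr M) (hr : M.eRk (G : Set α) = 4)
    (hng : ¬ Generic M G) (hpl : ∀ P ∈ planes M, (P ∩ G).card + 3 ≤ G.card) (hg8 : 8 ≤ G.card)
    (hg9 : G.card ≤ 9) : 0 ≤ J M G 4 := by
  obtain ⟨D, -⟩ := exists_PLData hs hG hr hng
  have hle := D.J15'_profile_le hs hG hr hpl (by omega) (by omega)
  have hmem := D.profile_mem_LISTK hs hG hpl (by omega) (by omega)
  rcases (show G.card = 8 ∨ G.card = 9 by omega) with h8 | h9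
  · rw [h8] at hmem
    by_cases hπ : D.profile = PL.pi0
    · have := D.fifteen_J_ge_of_profile_pi0 hs hG hr hpl h8 hπ
      linarith
    · have hpos : (0 : ℚ) < PL.J15' D.profile := by exact_mod_cast PL.J15'_pos_of_mem_8 hmem hπ
      linarith
  · rw [h9] at hmem
    have hpos : (0 : ℚ) < PL.J15' D.profile := by exact_mod_cast PL.J15'_pos_of_mem_9 hmem
    linarith

end PercRepro.SixFour
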